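import Literature.Geometry.Lorentzian.BogovskiiDoubleDivergence
import HarnessLib

/-!
# The Bogovskiĭ-type kernel of Mao–Oh–Tao's Lemma 2.3, second order:
# `∂_i∂_j Ψ_η(z + y, y) = δ₀ − 4η(z + y) − zⁱ(∂ᵢη)(z + y)`

(trunk G08 = T-LORENTZ; family `gr`; namespace `Literature.Geometry.Lorentzian.MaoOhTao`.)

Continuation of `BogovskiiDoubleDivergence.lean` (theorems only).  For the Bogovskiĭ-type kernel
`Ψ^{ij}_η(z + y, y) = w_y(|z|, z/|z|) zⁱzʲ/|z|³`, `w_y = bogovskiiWeight η y`, of Mao–Oh–Tao (arXiv:2308.13031),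
Lemma 2.3, the proof of (S2) on p. 9 computes

  `∂_{zⁱ}∂_{zʲ} Ψ_η(z + y, y) = ∂_{zⁱ}[ (zⁱ/|z|³) ∫_{|z|}^∞ η r² dr ] − ∂_{zⁱ}[ zⁱ η(z + y) ]`
  `                         = δ₀(z) − 4η(z + y) − zⁱ(∂ᵢη)(z + y)`   (`∫ η = 1`).

We prove this in weak form (`sum_sum_integral_bogovskiiKernel_pd_pd_eq`): for `η ∈ C¹_c(ℝ³)` vanishing off `B̄_R`,
`y ∈ ℝ³` and `ψ ∈ C²_c(ℝ³)`,

  `Σ_{i,j} ∫ w_y zᵢzⱼ|z|⁻³ ∂ⱼ∂ᵢψ(z) dz = ψ(0) ∫ η − 4 ∫ η(z + y) ψ(z) dz − ∫ (Σᵢ zᵢ(∂ᵢη)(z + y)) ψ(z) dz`,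

by the radial method of `ConicBogovskiiDelta.lean`: the inner sums are per-index pairings
`∫ w_y zᵢ|z|⁻³ Dg·z = −∫_0^∞ ∫ w_y αᵢ g(rα) dσ dr + ∫ η(z + y) zᵢ g(z) dz` (`integral_bogovskiiKernel_fderiv_apply_self_eq`,
radial integration by parts with the extra `∂_r w_y = −r² η(rα + y)` term), `Σᵢ αᵢ∂ᵢψ(rα) = (d/dr)ψ(rα)` brings in the
Bogovskiĭ identity of the previous file, and the `η`-terms are integrated by parts (`sum_integral_eta_coord_pd_eq`).
With the moment conditions `∫ f = ∫ x_j f = 0` this is what makes `∂_i∂_j (S f)^{ij} = f` (the operator-level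
statement, a Fubini argument for `(S f)(x) = ∫ Ψ(x, y) f(y) dy`, is not treated here).

Integrated against a continuous compactly supported density `f` with `∫ f = 0`, `∫ yᵢ f = 0`, the formula gives
`∫ f(y) [Σ_{i,j} ∫ Ψ^{ij}_η(z + y, y) ∂ⱼ∂ᵢψ(z + y) dz] dy = (∫ η) ∫ f ψ` (`integral_mul_sum_sum_integral_bogovskiiKernel_eq`),
which is (S2) for `(S f)^{ij}(x) = ∫ Ψ^{ij}_η(x, y) f(y) dy` up to the exchange of the two integrations
(`BogovskiiOperator.lean`).

Everything is proved; no definitions, no named facts.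

## References

* Y. Mao, S.-J. Oh, T. Tao, arXiv:2308.13031 (2023), Lemma 2.3 and its proof, p. 9 (key `MaoOhTao2023`).
* M. E. Bogovskiĭ, Dokl. Akad. Nauk SSSR 248 (1979), 1037–1040.
-/

noncomputable section

open scoped RealInnerProductSpace Topology ContDiff
open Filter MeasureTheory Set Metric Function
open Literature.Analysis.FluidPDE

namespace Literature.Geometry.Lorentzian

namespace MaoOhTao

/-! ### The second-order formula `∂_i∂_j Ψ_η(z + y, y) = δ₀ − 4η(z + y) − zⁱ(∂ᵢη)(z + y)` -/

section SecondOrder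

variable {η ψ : E3 → ℝ} {y : E3} {R : ℝ}

/-- `|zᵢ| ≤ |z|` (a private copy of a FluidPDE helper). [folklore] -/
private theorem abs_apply_le_norm' (v : E3) (i : Fin 3) : |v i| ≤ ‖v‖ := by
  simpa using PiLp.norm_apply_le v i

/-- **Per-index radial integration by parts for the Bogovskiĭ kernel.** For `η ∈ C_c`, `g ∈ C¹_c` and an index `i`,
`∫ w_y zᵢ |z|⁻³ Dg(z)·z dz = −∫_0^∞ ∫_{S²} w_y(r,α) αᵢ g(rα) dσ dr + ∫ η(z + y) zᵢ g(z) dz`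
(polar coordinates, `∫_0^∞ r H' = −∫_0^∞ H` for `H(r) = ∫ w_y αᵢ g(rα) dσ`, the `∂_r w_y`-part of `H'` being
`−r² ∫ η(rα + y) αᵢ g(rα) dσ`). [cite: MaoOhTao2023, Lemma 2.3 (proof)] -/
theorem integral_bogovskiiKernel_fderiv_apply_self_eq (hη : Continuous η) (hR : ∀ z : E3, R < ‖z‖ → η z = 0)
    {g : E3 → ℝ} (hg : ContDiff ℝ 1 g) (hgc : HasCompactSupport g) (y : E3) (i : Fin 3) :
    ∫ z : E3, bogovskiiWeight η y ‖z‖ (‖z‖⁻¹ • z) * (z i * (‖z‖ ^ 3)⁻¹) * fderiv ℝ g z z =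
      -(∫ r in Ioi (0 : ℝ), ∫ α, (bogovskiiWeight η y r (α : E3) * (α : E3) i) * g (r • (α : E3))
          ∂(volume : Measure E3).toSphere) +
        ∫ z : E3, η (z + y) * (z i * g z) := by
  obtain ⟨Rg, hRg⟩ := hgc.isCompact.isBounded.subset_closedBall 0
  -- the weight `w_i = w αᵢ` and its radial derivative
  set w : ℝ → sphere (0 : E3) 1 → ℝ := fun r α ↦ bogovskiiWeight η y r (α : E3) * (α : E3) i with hw
  set w' : ℝ → sphere (0 : E3) 1 → ℝ := fun r α ↦ -(η (r • (α : E3) + y) * r ^ 2) * (α : E3) i with hw'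
  have hproj : Continuous fun q : ℝ × sphere (0 : E3) 1 ↦ (q.2 : E3) i :=
    (EuclideanSpace.proj (𝕜 := ℝ) i).continuous.comp (continuous_subtype_val.comp continuous_snd)
  have hwc : Continuous (uncurry w) := (continuous_bogovskiiWeight_sphere hη hR y).mul hproj
  have hw'c : Continuous (uncurry w') :=
    ((hη.comp ((continuous_fst.smul (continuous_subtype_val.comp continuous_snd)).add
      continuous_const)).mul (continuous_fst.pow 2)).neg.mul hproj
  have hwd : ∀ r α, HasDerivAt (fun ρ ↦ w ρ α) (w' r α) r := fun r α ↦
    (hasDerivAt_bogovskiiWeight hη hR (norm_eq_of_mem_sphere α) y r).mul_const _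
  have hH := fun r ↦ hasDerivAt_integral_rweight_mul hwc hw'c hwd hg r
  -- vanishing for large radius
  set T : ℝ := max (R + ‖y‖) Rg with hT
  have hw0 : ∀ ρ, T < ρ → ∀ α : sphere (0 : E3) 1, w ρ α = 0 := fun ρ hρ α ↦ by
    simp only [hw]
    rw [bogovskiiWeight_eq_zero_of_le hR (norm_eq_of_mem_sphere α) ((le_max_left _ _).trans hρ.le), zero_mul]
  have hw'0 : ∀ ρ, T < ρ → ∀ α : sphere (0 : E3) 1, w' ρ α = 0 := fun ρ hρ α ↦ by
    simp only [hw']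
    rw [eta_line_eq_zero hR (norm_eq_of_mem_sphere α)
      (((le_max_left _ _).trans_lt hρ).trans_le (le_abs_self ρ)), zero_mul, neg_zero, zero_mul]
  have hH0 : ∀ ρ, T < ρ → (∫ α, w ρ α * g (ρ • (α : E3)) ∂(volume : Measure E3).toSphere) = 0 :=
    fun ρ hρ ↦ by simp [hw0 ρ hρ]
  have hH'0 : ∀ ρ, T < ρ → (∫ α, (w' ρ α * g (ρ • (α : E3)) + w ρ α * fderiv ℝ g (ρ • (α : E3)) (α : E3))
      ∂(volume : Measure E3).toSphere) = 0 := fun ρ hρ ↦ by simp [hw0 ρ hρ, hw'0 ρ hρ]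
  have hA0 : ∀ ρ, T < ρ → (∫ α, w' ρ α * g (ρ • (α : E3)) ∂(volume : Measure E3).toSphere) = 0 :=
    fun ρ hρ ↦ by simp [hw'0 ρ hρ]
  have hH'c := continuous_integral_rweight_deriv hwc hw'c hg
  have hAc : Continuous fun ρ : ℝ ↦ ∫ α, w' ρ α * g (ρ • (α : E3)) ∂(volume : Measure E3).toSphere :=
    continuous_integral_rweight hw'c hg.continuous
  -- radial integration by parts: `∫_0^∞ r H' = -∫_0^∞ H`
  have hIBP := integral_Ioi_mul_deriv_eq_neg_integral hH hH'c (R := T) hH0 hH'0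
  -- split `H' = A + B`
  have hsplit : ∀ ρ, (∫ α, (w' ρ α * g (ρ • (α : E3)) + w ρ α * fderiv ℝ g (ρ • (α : E3)) (α : E3))
      ∂(volume : Measure E3).toSphere) =
      (∫ α, w' ρ α * g (ρ • (α : E3)) ∂(volume : Measure E3).toSphere) +
        ∫ α, w ρ α * fderiv ℝ g (ρ • (α : E3)) (α : E3) ∂(volume : Measure E3).toSphere := by
    intro ρ
    have hc1 : Continuous fun α : sphere (0 : E3) 1 ↦ w' ρ α * g (ρ • (α : E3)) :=
      hw'c.comp (Continuous.prodMk_right ρ) |>.mul (hg.continuous.comp (continuous_subtype_val.const_smul ρ))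
    have hc2 : Continuous fun α : sphere (0 : E3) 1 ↦ w ρ α * fderiv ℝ g (ρ • (α : E3)) (α : E3) :=
      (hwc.comp (Continuous.prodMk_right ρ)).mul
        ((((hg.continuous_fderiv one_ne_zero).comp (continuous_subtype_val.const_smul ρ))).clm_apply
          continuous_subtype_val)
    exact integral_add (integrableOn_univ.1 (hc1.continuousOn.integrableOn_compact isCompact_univ))
      (integrableOn_univ.1 (hc2.continuousOn.integrableOn_compact isCompact_univ))
  have hAint : IntegrableOn (fun ρ : ℝ ↦ ρ * ∫ α, w' ρ α * g (ρ • (α : E3)) ∂(volume : Measure E3).toSphere)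
      (Ioi 0) :=
    integrableOn_Ioi_of_eq_zero_of_lt (continuous_id.mul hAc) fun ρ hρ ↦ by rw [hA0 ρ hρ, mul_zero]
  have hH'int : IntegrableOn (fun ρ : ℝ ↦ ρ * ∫ α, (w' ρ α * g (ρ • (α : E3)) +
      w ρ α * fderiv ℝ g (ρ • (α : E3)) (α : E3)) ∂(volume : Measure E3).toSphere) (Ioi 0) :=
    integrableOn_Ioi_of_eq_zero_of_lt (continuous_id.mul hH'c) fun ρ hρ ↦ by rw [hH'0 ρ hρ, mul_zero]
  have hBint : IntegrableOn (fun ρ : ℝ ↦ ρ * ∫ α, w ρ α * fderiv ℝ g (ρ • (α : E3)) (α : E3)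
      ∂(volume : Measure E3).toSphere) (Ioi 0) := by
    refine (hH'int.sub hAint).congr_fun (fun ρ _ ↦ ?_) measurableSet_Ioi
    simp only [Pi.sub_apply]
    rw [hsplit ρ]
    ring
  have hB : ∫ ρ in Ioi (0 : ℝ), ρ * ∫ α, w ρ α * fderiv ℝ g (ρ • (α : E3)) (α : E3)
      ∂(volume : Measure E3).toSphere =
      (∫ ρ in Ioi (0 : ℝ), ρ * ∫ α, (w' ρ α * g (ρ • (α : E3)) +
        w ρ α * fderiv ℝ g (ρ • (α : E3)) (α : E3)) ∂(volume : Measure E3).toSphere) -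
      ∫ ρ in Ioi (0 : ℝ), ρ * ∫ α, w' ρ α * g (ρ • (α : E3)) ∂(volume : Measure E3).toSphere := by
    rw [← integral_sub hH'int hAint]
    refine setIntegral_congr_fun measurableSet_Ioi fun ρ _ ↦ ?_
    rw [hsplit ρ]
    ring
  -- the `∂_r w`-term in polar coordinates: `-∫_0^∞ r A = ∫ η(z + y) zᵢ g(z) dz`
  have hpolarA : ∫ z : E3, η (z + y) * (z i * g z) =
      -∫ ρ in Ioi (0 : ℝ), ρ * ∫ α, w' ρ α * g (ρ • (α : E3)) ∂(volume : Measure E3).toSphere := by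
    have hi : Integrable fun z : E3 ↦ η (z + y) * (z i * g z) :=
      ((hη.comp (continuous_id.add continuous_const)).mul
        ((EuclideanSpace.proj (𝕜 := ℝ) i).continuous.mul hg.continuous)).integrable_of_hasCompactSupport
        (hgc.mul_left.mul_left)
    rw [integral_eq_integral_Ioi_sphereIntegral (volume : Measure E3) hi, ← integral_neg]
    refine setIntegral_congr_fun measurableSet_Ioi fun ρ _ ↦ ?_
    have hdim : Module.finrank ℝ E3 - 1 = 2 := by rw [finrank_euclideanSpace_fin]
    rw [hdim, smul_eq_mul, sphereIntegral_def, ← integral_const_mul, ← neg_mul, ← integral_const_mul]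
    refine integral_congr_ae (ae_of_all _ fun α ↦ ?_)
    simp only [hw', PiLp.smul_apply, smul_eq_mul]
    ring
  -- the left-hand side in polar coordinates: `∫_0^∞ r B`
  obtain ⟨W, hW⟩ := exists_abs_bogovskiiWeight_norm_le hη hR y
  obtain ⟨C, -, hC⟩ := exists_bound_coord_mul_fderiv hg hgc
  have hint : Integrable fun z : E3 ↦
      bogovskiiWeight η y ‖z‖ (‖z‖⁻¹ • z) * ((‖z‖ ^ 3)⁻¹ * (z i * fderiv ℝ g z z)) := by
    refine integrable_weight_mul_of_le (continuousOn_bogovskiiWeight_norm hη hR y) hW ?_ ?_ (C := C)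
      fun z ↦ hC z z i
    · exact (EuclideanSpace.proj (𝕜 := ℝ) i).continuous.mul
        ((hg.continuous_fderiv one_ne_zero).clm_apply continuous_id)
    · refine (hgc.fderiv (𝕜 := ℝ)).mono (support_subset_iff'.2 fun z hz ↦ ?_)
      rw [notMem_support.1 hz]
      simp
  have hLHS : ∫ z : E3, bogovskiiWeight η y ‖z‖ (‖z‖⁻¹ • z) * (z i * (‖z‖ ^ 3)⁻¹) * fderiv ℝ g z z =
      ∫ ρ in Ioi (0 : ℝ), ρ * ∫ α, w ρ α * fderiv ℝ g (ρ • (α : E3)) (α : E3)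
        ∂(volume : Measure E3).toSphere := by
    have heq : (fun z : E3 ↦ bogovskiiWeight η y ‖z‖ (‖z‖⁻¹ • z) * (z i * (‖z‖ ^ 3)⁻¹) * fderiv ℝ g z z) =
        fun z ↦ bogovskiiWeight η y ‖z‖ (‖z‖⁻¹ • z) * ((‖z‖ ^ 3)⁻¹ * (z i * fderiv ℝ g z z)) := by
      funext z; ring
    rw [heq, integral_eq_integral_Ioi_sphereIntegral (volume : Measure E3) hint]
    refine setIntegral_congr_fun measurableSet_Ioi fun r hr ↦ ?_
    have hr0 : (0 : ℝ) < r := hr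
    have hdim : Module.finrank ℝ E3 - 1 = 2 := by rw [finrank_euclideanSpace_fin]
    rw [hdim, smul_eq_mul, sphereIntegral_def, ← integral_const_mul, ← integral_const_mul]
    refine integral_congr_ae (ae_of_all _ fun α ↦ ?_)
    simp only [hw, PiLp.smul_apply, smul_eq_mul]
    rw [norm_smul_sphere hr0.le α, smul_smul, inv_mul_cancel₀ hr0.ne', one_smul, map_smul, smul_eq_mul]
    field_simp
  rw [hLHS, hB, hIBP, hpolarA]
  ring

/-- The pairings `∫ w_y zᵢzⱼ|z|⁻³ ∂ⱼ∂ᵢψ` converge absolutely for `ψ ∈ C²_c(ℝ³)`. [folklore] -/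
theorem integrable_bogovskiiKernel_mul_pd_pd (hη : Continuous η) (hR : ∀ z : E3, R < ‖z‖ → η z = 0)
    (hψ : ContDiff ℝ 2 ψ) (hψc : HasCompactSupport ψ) (y : E3) (i j : Fin 3) :
    Integrable fun z : E3 ↦
      bogovskiiWeight η y ‖z‖ (‖z‖⁻¹ • z) * (z i * (z j * (‖z‖ ^ 3)⁻¹)) * pd j (pd i ψ) z := by
  have hg : ContDiff ℝ 1 (pd i ψ) := contDiff_pd (n := 1) hψ i
  have hgc : HasCompactSupport (pd i ψ) := hasCompactSupport_pd hψc i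
  obtain ⟨W, hW⟩ := exists_abs_bogovskiiWeight_norm_le hη hR y
  obtain ⟨C, -, hC⟩ := exists_bound_coord_mul_fderiv hg hgc
  have hint : Integrable fun z : E3 ↦
      bogovskiiWeight η y ‖z‖ (‖z‖⁻¹ • z) * ((‖z‖ ^ 3)⁻¹ * (z i * (z j * pd j (pd i ψ) z))) := by
    refine integrable_weight_mul_of_le (continuousOn_bogovskiiWeight_norm hη hR y) hW ?_ ?_ (C := C)
      fun z ↦ ?_
    · exact (EuclideanSpace.proj (𝕜 := ℝ) i).continuous.mul
        ((EuclideanSpace.proj (𝕜 := ℝ) j).continuous.mul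
          ((hg.continuous_fderiv one_ne_zero).clm_apply continuous_const))
    · refine (hgc.fderiv_apply (𝕜 := ℝ) (e j)).mono (support_subset_iff'.2 fun z hz ↦ ?_)
      have h0 : fderiv ℝ (pd i ψ) z (e j) = 0 := notMem_support.1 hz
      simp only [pd] at h0 ⊢
      rw [h0]
      simp
    · rw [abs_mul]
      calc |z i| * |z j * pd j (pd i ψ) z| ≤ ‖z‖ * (C * ‖e j‖) :=
            mul_le_mul (abs_apply_le_norm' z i) (hC z (e j) j) (abs_nonneg _) (norm_nonneg _)
        _ = C * ‖z‖ := by rw [show ‖e j‖ = 1 by simp [e]]; ring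
  refine hint.congr (Eventually.of_forall fun z ↦ ?_)
  simp only
  ring

/-- `∂ᵢ[η(· + y)](z) = (∂ᵢη)(z + y)`. [folklore] -/
theorem pd_comp_add_const (η : E3 → ℝ) (y z : E3) (i : Fin 3) :
    pd i (fun x ↦ η (x + y)) z = pd i η (z + y) := by
  simp only [pd, fderiv_comp_add_right]

/-- The integration by parts `Σ_i ∫ η(z + y) zᵢ ∂ᵢψ(z) dz = −3 ∫ η(z + y) ψ(z) dz − ∫ (z·∇η)(z + y) ψ(z) dz` for
`η ∈ C¹`, `ψ ∈ C¹_c` (`∂ᵢ(zᵢ η(z + y)) = η(z + y) + zᵢ (∂ᵢη)(z + y)`). [folklore] -/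
theorem sum_integral_eta_coord_pd_eq (hη : ContDiff ℝ 1 η) (hψ : ContDiff ℝ 1 ψ) (hψc : HasCompactSupport ψ)
    (y : E3) :
    ∑ i, ∫ z : E3, η (z + y) * (z i * pd i ψ z) =
      -(3 * ∫ z : E3, η (z + y) * ψ z) - ∫ z : E3, (∑ i, z i * pd i η (z + y)) * ψ z := by
  have hηt : ContDiff ℝ 1 fun x : E3 ↦ η (x + y) := hη.comp (contDiff_id.add contDiff_const)
  have hηd : Differentiable ℝ fun x : E3 ↦ η (x + y) := hηt.differentiable one_ne_zero
  have hgi : ∀ i, ContDiff ℝ 1 fun x : E3 ↦ x i * η (x + y) := fun i ↦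
    (EuclideanSpace.proj (𝕜 := ℝ) i).contDiff.mul hηt
  have hI1 : Integrable fun z : E3 ↦ η (z + y) * ψ z :=
    ((hη.continuous.comp (continuous_id.add continuous_const)).mul hψ.continuous).integrable_of_hasCompactSupport
      hψc.mul_left
  have hI2 : ∀ i, Integrable fun z : E3 ↦ (z i * pd i η (z + y)) * ψ z := fun i ↦
    (((EuclideanSpace.proj (𝕜 := ℝ) i).continuous.mul
      (((hη.continuous_fderiv one_ne_zero).comp (continuous_id.add continuous_const)).clm_apply
        continuous_const)).mul hψ.continuous).integrable_of_hasCompactSupport hψc.mul_left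
  -- integrate by parts in each direction
  have hterm : ∀ i, ∫ z : E3, η (z + y) * (z i * pd i ψ z) =
      -(∫ z : E3, η (z + y) * ψ z) - ∫ z : E3, (z i * pd i η (z + y)) * ψ z := by
    intro i
    have h := integral_pd_mul_eq_neg hψ hψc (hgi i) i
    have e1 : (fun z : E3 ↦ η (z + y) * (z i * pd i ψ z)) = fun z ↦ pd i ψ z * (z i * η (z + y)) := by
      funext z; ring
    have e2 : ∫ z : E3, ψ z * pd i (fun x : E3 ↦ x i * η (x + y)) z =
        (∫ z : E3, η (z + y) * ψ z) + ∫ z : E3, (z i * pd i η (z + y)) * ψ z := by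
      rw [← integral_add hI1 (hI2 i)]
      refine integral_congr_ae (ae_of_all _ fun z ↦ ?_)
      simp only
      rw [pd_coord_mul i (hηd z), pd_comp_add_const]
      simp only [if_true]
      ring
    rw [e1, h, e2]
    ring
  rw [Finset.sum_congr rfl fun i _ ↦ hterm i, Finset.sum_sub_distrib, Finset.sum_const, Finset.card_univ,
    Fintype.card_fin, ← integral_finsetSum _ fun i _ ↦ hI2 i]
  have e3 : ∫ z : E3, ∑ i, (z i * pd i η (z + y)) * ψ z = ∫ z : E3, (∑ i, z i * pd i η (z + y)) * ψ z :=
    integral_congr_ae (ae_of_all _ fun z ↦ by simp only [Finset.sum_mul])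
  rw [e3]
  simp only [nsmul_eq_mul, Nat.cast_ofNat]
  ring

/-- **`∂_i∂_j Ψ_η(z + y, y) = (∫ η) δ₀(z) − 4η(z + y) − zⁱ(∂ᵢη)(z + y)`, weak form** (Mao–Oh–Tao, proof of Lemma 2.3,
p. 9): for `η ∈ C¹_c(ℝ³)` vanishing off `B̄_R`, `y ∈ ℝ³` and `ψ ∈ C²_c(ℝ³)`,
`Σ_{i,j} ∫ w_y(|z|, z/|z|) zᵢzⱼ|z|⁻³ ∂ⱼ∂ᵢψ(z) dz = ψ(0) ∫ η − 4 ∫ η(z + y) ψ(z) dz − ∫ (Σᵢ zᵢ (∂ᵢη)(z + y)) ψ(z) dz`.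
With `∫ η = 1` and the moment conditions `∫ f = ∫ x_j f = 0` this yields (S2), `∂_i∂_j (S f)^{ij} = f`, for the
operator `(S f)^{ij}(x) = ∫ Ψ^{ij}_η(x, y) f(y) dy`. Proof: the inner sums are the per-index pairings
(`integral_bogovskiiKernel_fderiv_apply_self_eq`); `Σ_i αᵢ ∂ᵢψ(rα) = (d/dr) ψ(rα)` brings in the radial Bogovskiĭ
identity (`integral_Ioi_integral_bogovskiiWeight_mul_fderiv`), and the `η`-terms are integrated by parts
(`sum_integral_eta_coord_pd_eq`). [cite: MaoOhTao2023, Lemma 2.3 (proof)] -/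
theorem sum_sum_integral_bogovskiiKernel_pd_pd_eq (hη : ContDiff ℝ 1 η) (hR : ∀ z : E3, R < ‖z‖ → η z = 0)
    (hψ : ContDiff ℝ 2 ψ) (hψc : HasCompactSupport ψ) (y : E3) :
    ∑ i, ∑ j, ∫ z : E3,
        bogovskiiWeight η y ‖z‖ (‖z‖⁻¹ • z) * (z i * (z j * (‖z‖ ^ 3)⁻¹)) * pd j (pd i ψ) z =
      ψ 0 * (∫ z : E3, η z) - 4 * (∫ z : E3, η (z + y) * ψ z) -
        ∫ z : E3, (∑ i, z i * pd i η (z + y)) * ψ z := by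
  have hηc : Continuous η := hη.continuous
  have hψ1 : ContDiff ℝ 1 ψ := hψ.of_le one_le_two
  have hg : ∀ i, ContDiff ℝ 1 (pd i ψ) := fun i ↦ contDiff_pd (n := 1) hψ i
  have hgc : ∀ i, HasCompactSupport (pd i ψ) := fun i ↦ hasCompactSupport_pd hψc i
  obtain ⟨Rψ, hRψ⟩ := hψc.isCompact.isBounded.subset_closedBall 0
  -- the inner sums are the per-index pairings
  have hi : ∀ i, ∑ j, ∫ z : E3,
      bogovskiiWeight η y ‖z‖ (‖z‖⁻¹ • z) * (z i * (z j * (‖z‖ ^ 3)⁻¹)) * pd j (pd i ψ) z =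
      ∫ z : E3, bogovskiiWeight η y ‖z‖ (‖z‖⁻¹ • z) * (z i * (‖z‖ ^ 3)⁻¹) * fderiv ℝ (pd i ψ) z z := by
    intro i
    rw [← integral_finsetSum _ fun j _ ↦ integrable_bogovskiiKernel_mul_pd_pd hηc hR hψ hψc y i j]
    refine integral_congr_ae (ae_of_all _ fun z ↦ ?_)
    simp only
    rw [fderiv_apply_self_eq_sum, Finset.mul_sum]
    exact Finset.sum_congr rfl fun j _ ↦ by simp only [pd]; ring
  rw [Finset.sum_congr rfl fun i _ ↦ hi i,
    Finset.sum_congr rfl fun i _ ↦ integral_bogovskiiKernel_fderiv_apply_self_eq hηc hR (hg i) (hgc i) y i,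
    Finset.sum_add_distrib, Finset.sum_neg_distrib]
  -- the radial integrands `H_i(r) = ∫ w αᵢ ∂ᵢψ(rα) dσ`
  have hwc : Continuous (uncurry fun (r : ℝ) (α : sphere (0 : E3) 1) ↦ bogovskiiWeight η y r (α : E3)) :=
    continuous_bogovskiiWeight_sphere hηc hR y
  have hw : ∀ i, Continuous (uncurry fun (r : ℝ) (α : sphere (0 : E3) 1) ↦
      bogovskiiWeight η y r (α : E3) * (α : E3) i) := fun i ↦
    hwc.mul ((EuclideanSpace.proj (𝕜 := ℝ) i).continuous.comp (continuous_subtype_val.comp continuous_snd))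
  have hHint : ∀ i, IntegrableOn (fun r : ℝ ↦ ∫ α, (bogovskiiWeight η y r (α : E3) * (α : E3) i) *
      pd i ψ (r • (α : E3)) ∂(volume : Measure E3).toSphere) (Ioi 0) := fun i ↦ by
    refine integrableOn_Ioi_of_eq_zero_of_lt (continuous_integral_rweight (hw i) (hg i).continuous)
      (R := R + ‖y‖) fun r hr ↦ ?_
    have h : ∀ α : sphere (0 : E3) 1, bogovskiiWeight η y r (α : E3) = 0 := fun α ↦
      bogovskiiWeight_eq_zero_of_le hR (norm_eq_of_mem_sphere α) hr.le
    simp [h]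
  rw [← integral_finsetSum _ fun i _ ↦ hHint i]
  -- `Σ_i w αᵢ ∂ᵢψ(rα) = w Dψ(rα)·α`
  have hG' : ∀ r : ℝ, ∑ i, (∫ α, (bogovskiiWeight η y r (α : E3) * (α : E3) i) * pd i ψ (r • (α : E3))
      ∂(volume : Measure E3).toSphere) =
      ∫ α, bogovskiiWeight η y r (α : E3) * fderiv ℝ ψ (r • (α : E3)) (α : E3)
        ∂(volume : Measure E3).toSphere := by
    intro r
    have hint : ∀ i, Integrable (fun α : sphere (0 : E3) 1 ↦
        (bogovskiiWeight η y r (α : E3) * (α : E3) i) * pd i ψ (r • (α : E3))) (volume : Measure E3).toSphere :=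
      fun i ↦ by
      have hc : Continuous fun α : sphere (0 : E3) 1 ↦
          (bogovskiiWeight η y r (α : E3) * (α : E3) i) * pd i ψ (r • (α : E3)) :=
        ((hw i).comp (Continuous.prodMk_right r)).mul
          ((hg i).continuous.comp (continuous_subtype_val.const_smul r))
      exact integrableOn_univ.1 (hc.continuousOn.integrableOn_compact isCompact_univ)
    rw [← integral_finsetSum _ fun i _ ↦ hint i]
    refine integral_congr_ae (ae_of_all _ fun α ↦ ?_)
    simp only
    rw [fderiv_apply_eq_sum ψ (r • (α : E3)) (α : E3), Finset.mul_sum]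
    exact Finset.sum_congr rfl fun i _ ↦ by ring
  rw [setIntegral_congr_fun measurableSet_Ioi fun r _ ↦ hG' r,
    integral_Ioi_integral_bogovskiiWeight_mul_fderiv hηc hR hψ1 hψc y,
    sum_integral_eta_coord_pd_eq hη hψ1 hψc y]
  ring

/-- **(S2) for a normalised bump.** With `∫ η = 1`:
`Σ_{i,j} ∫ w_y zᵢzⱼ|z|⁻³ ∂ⱼ∂ᵢψ dz = ψ(0) − 4 ∫ η(z + y) ψ(z) dz − ∫ (z·∇η)(z + y) ψ(z) dz`, the weak form of
`∂_i∂_j Ψ_η(z + y, y) = δ₀(z) − 4η(z + y) − zⁱ(∂ᵢη)(z + y)`. [cite: MaoOhTao2023, Lemma 2.3 (proof)] -/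
theorem sum_sum_integral_bogovskiiKernel_pd_pd_eq_of_integral_eq_one (hη : ContDiff ℝ 1 η)
    (hR : ∀ z : E3, R < ‖z‖ → η z = 0) (hη1 : ∫ z : E3, η z = 1) (hψ : ContDiff ℝ 2 ψ)
    (hψc : HasCompactSupport ψ) (y : E3) :
    ∑ i, ∑ j, ∫ z : E3,
        bogovskiiWeight η y ‖z‖ (‖z‖⁻¹ • z) * (z i * (z j * (‖z‖ ^ 3)⁻¹)) * pd j (pd i ψ) z =
      ψ 0 - 4 * (∫ z : E3, η (z + y) * ψ z) - ∫ z : E3, (∑ i, z i * pd i η (z + y)) * ψ z := by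
  rw [sum_sum_integral_bogovskiiKernel_pd_pd_eq hη hR hψ hψc y, hη1, mul_one]

end SecondOrder

/-! ### (S2) under the moment conditions, integrated against `f` -/

section Moments

variable {η ψ : E3 → ℝ} {R : ℝ}

/-- The second-order formula against a translate `ψ(· + y)`, with the `η`-integrals recentred:
`Σ_{i,j} ∫ w_y zᵢzⱼ|z|⁻³ (∂ⱼ∂ᵢψ)(z + y) dz = ψ(y) ∫ η − 4 ∫ η ψ − ∫ (x·∇η) ψ + Σᵢ yᵢ ∫ (∂ᵢη) ψ`.
[cite: MaoOhTao2023, Lemma 2.3 (proof)] -/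
theorem sum_sum_integral_bogovskiiKernel_pd_pd_add_eq (hη : ContDiff ℝ 1 η)
    (hR : ∀ z : E3, R < ‖z‖ → η z = 0) (hψ : ContDiff ℝ 2 ψ) (hψc : HasCompactSupport ψ) (y : E3) :
    ∑ i, ∑ j, ∫ z : E3,
        bogovskiiWeight η y ‖z‖ (‖z‖⁻¹ • z) * (z i * (z j * (‖z‖ ^ 3)⁻¹)) * pd j (pd i ψ) (z + y) =
      ψ y * (∫ z : E3, η z) - 4 * (∫ x : E3, η x * ψ x) - (∫ x : E3, (∑ i, x i * pd i η x) * ψ x) +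
        ∑ i, y i * ∫ x : E3, pd i η x * ψ x := by
  -- apply the second-order formula to `ψ(· + y)`
  have hψt : ContDiff ℝ 2 fun z : E3 ↦ ψ (z + y) := hψ.comp (contDiff_id.add contDiff_const)
  obtain ⟨Rψ, hRψ⟩ := hψc.isCompact.isBounded.subset_closedBall 0
  have hψtc : HasCompactSupport fun z : E3 ↦ ψ (z + y) := by
    refine HasCompactSupport.intro (isCompact_closedBall (-y) Rψ) fun z hz ↦ eq_zero_of_lt_norm hRψ ?_
    rwa [mem_closedBall, not_le, dist_eq_norm, sub_neg_eq_add] at hz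
  have key := sum_sum_integral_bogovskiiKernel_pd_pd_eq hη hR hψt hψtc y
  have hpd : ∀ i j (z : E3), pd j (pd i (fun x : E3 ↦ ψ (x + y))) z = pd j (pd i ψ) (z + y) := by
    intro i j z
    have h1 : pd i (fun x : E3 ↦ ψ (x + y)) = fun x ↦ pd i ψ (x + y) := funext fun x ↦ pd_comp_add_const ψ y x i
    rw [h1, pd_comp_add_const]
  simp only [hpd, zero_add] at key
  rw [key]
  -- recentre the `η`-integrals: `x = z + y`
  have e1 : ∫ z : E3, η (z + y) * ψ (z + y) = ∫ x : E3, η x * ψ x :=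
    integral_add_right_eq_self (fun x : E3 ↦ η x * ψ x) y
  have hI1 : Integrable fun x : E3 ↦ (∑ i, x i * pd i η x) * ψ x :=
    ((continuous_finsetSum _ fun i _ ↦ (EuclideanSpace.proj (𝕜 := ℝ) i).continuous.mul
      ((hη.continuous_fderiv one_ne_zero).clm_apply continuous_const)).mul hψ.continuous)
      |>.integrable_of_hasCompactSupport hψc.mul_left
  have hI2 : ∀ i, Integrable fun x : E3 ↦ pd i η x * ψ x := fun i ↦
    (((hη.continuous_fderiv one_ne_zero).clm_apply continuous_const).mul hψ.continuous)
      |>.integrable_of_hasCompactSupport hψc.mul_left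
  have e2 : ∫ z : E3, (∑ i, z i * pd i η (z + y)) * ψ (z + y) =
      (∫ x : E3, (∑ i, x i * pd i η x) * ψ x) - ∑ i, y i * ∫ x : E3, pd i η x * ψ x := by
    have h : ∫ z : E3, (∑ i, (z + y - y) i * pd i η (z + y)) * ψ (z + y) =
        ∫ x : E3, (∑ i, (x - y) i * pd i η x) * ψ x :=
      integral_add_right_eq_self (μ := (volume : Measure E3)) (fun x : E3 ↦ (∑ i, (x - y) i * pd i η x) * ψ x) y
    simp only [add_sub_cancel_right] at h
    rw [h]
    have e3 : (fun x : E3 ↦ (∑ i, (x - y) i * pd i η x) * ψ x) =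
        fun x ↦ (∑ i, x i * pd i η x) * ψ x - ∑ i, y i * (pd i η x * ψ x) := by
      funext x
      simp only [PiLp.sub_apply, sub_mul, Finset.sum_sub_distrib, Finset.sum_mul]
      congr 1
      exact Finset.sum_congr rfl fun i _ ↦ by ring
    rw [e3, integral_sub hI1 (integrable_finsetSum _ fun i _ ↦ (hI2 i).const_mul (y i)),
      integral_finsetSum _ fun i _ ↦ (hI2 i).const_mul (y i)]
    congr 1
    exact Finset.sum_congr rfl fun i _ ↦ integral_const_mul _ _
  rw [e1, e2]
  ring

/-- **(S2) of Lemma 2.3 under the moment conditions, integrated against the density.** For `η ∈ C¹_c` vanishing off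
`B̄_R`, `ψ ∈ C²_c`, and a continuous compactly supported `f` with `∫ f = 0` and `∫ yᵢ f(y) dy = 0` (`i = 1, 2, 3`),
`∫ f(y) [Σ_{i,j} ∫ Ψ^{ij}_η(z + y, y) (∂ⱼ∂ᵢψ)(z + y) dz] dy = (∫ η) ∫ f ψ`
— i.e. `⟨∂_i∂_j (S f)^{ij}, ψ⟩ = ⟨f, ψ⟩` for `(S f)^{ij}(x) = ∫ Ψ^{ij}_η(x, y) f(y) dy` and `∫ η = 1`, granted the
exchange of the `x`- and `y`-integrations: the terms `−4η(z + y) − zⁱ(∂ᵢη)(z + y)` of `∂_i∂_jΨ_η` pair to multiples of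
`∫ f` and `∫ yᵢ f`, which vanish. [cite: MaoOhTao2023, Lemma 2.3 (S2)] -/
theorem integral_mul_sum_sum_integral_bogovskiiKernel_eq (hη : ContDiff ℝ 1 η)
    (hR : ∀ z : E3, R < ‖z‖ → η z = 0) (hψ : ContDiff ℝ 2 ψ) (hψc : HasCompactSupport ψ) {f : E3 → ℝ}
    (hf : Continuous f) (hfc : HasCompactSupport f) (hf0 : ∫ y : E3, f y = 0)
    (hf1 : ∀ i : Fin 3, ∫ y : E3, y i * f y = 0) :
    ∫ y : E3, f y * ∑ i, ∑ j, ∫ z : E3,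
        bogovskiiWeight η y ‖z‖ (‖z‖⁻¹ • z) * (z i * (z j * (‖z‖ ^ 3)⁻¹)) * pd j (pd i ψ) (z + y) =
      (∫ z : E3, η z) * ∫ y : E3, f y * ψ y := by
  simp_rw [sum_sum_integral_bogovskiiKernel_pd_pd_add_eq hη hR hψ hψc]
  set I : ℝ := ∫ z : E3, η z
  set A : ℝ := ∫ x : E3, η x * ψ x
  set B : ℝ := ∫ x : E3, (∑ i, x i * pd i η x) * ψ x
  set C : Fin 3 → ℝ := fun i ↦ ∫ x : E3, pd i η x * ψ x
  have hIf : Integrable f := hf.integrable_of_hasCompactSupport hfc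
  have hIfψ : Integrable fun y : E3 ↦ f y * ψ y := (hf.mul hψ.continuous).integrable_of_hasCompactSupport hfc.mul_right
  have hIyf : ∀ i, Integrable fun y : E3 ↦ y i * f y := fun i ↦
    ((EuclideanSpace.proj (𝕜 := ℝ) i).continuous.mul hf).integrable_of_hasCompactSupport hfc.mul_left
  have e : (fun y : E3 ↦ f y * (ψ y * I - 4 * A - B + ∑ i, y i * C i)) =
      fun y ↦ I * (f y * ψ y) - (4 * A + B) * f y + ∑ i, C i * (y i * f y) := by
    funext y
    have : ∑ i, C i * (y i * f y) = f y * ∑ i, y i * C i := by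
      rw [Finset.mul_sum]
      exact Finset.sum_congr rfl fun i _ ↦ by ring
    rw [this]
    ring
  have h12 : Integrable fun y : E3 ↦ I * (f y * ψ y) - (4 * A + B) * f y :=
    (hIfψ.const_mul I).sub (hIf.const_mul _)
  have h3 : Integrable fun y : E3 ↦ ∑ i, C i * (y i * f y) :=
    integrable_finsetSum _ fun i _ ↦ (hIyf i).const_mul (C i)
  rw [e, integral_add h12 h3, integral_sub (hIfψ.const_mul I) (hIf.const_mul _), integral_const_mul,
    integral_const_mul, integral_finsetSum _ fun i _ ↦ (hIyf i).const_mul (C i)]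
  simp only [integral_const_mul, hf0, hf1, mul_zero, Finset.sum_const_zero, add_zero, sub_zero]

end Moments

end MaoOhTao

end Literature.Geometry.Lorentzian

end
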